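import Mathlib
import HarnessLib
import Literature.Probability.MarkovChains.RelaxationTime

/-!
# Bounds on the spectral gap via contractions: `|λ| ≤ θ`, `γ⋆ ≥ 1 − θ` (Levin–Peres–Wilmer Theorem 13.1, M.-F. Chen 1998)

HONEST FRAMING: exact (Metropolis-corrected) sampling algorithms for lattice gauge theory; figures
of merit are autocorrelation/cost numbers at stated couplings and volumes; no continuum-physics claim.

Conventions of `TotalVariation.lean` / `RelaxationTime.lean` / `RelaxationTimeLowerBound.lean`:
finite `X`, ROW kernel `P : X → X → ℝ`, complex eigenpairs `∀ x, Σ_y P(x,y) f(y) = λ f(x)`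
(`hasEigenvector_iff`), `nontrivialEigenvalues P` (the eigenvalues `≠ 1`), `lambdaStar P = λ⋆`,
`absSpectralGap P = γ⋆ = 1 − λ⋆`.  Source: D. A. Levin, Y. Peres (with E. L. Wilmer), *Markov Chains
and Mixing Times*, 2nd ed., AMS 2017 [LevinPeres2017], §13.1 (and §4.2 for couplings).  Everything
is PROVED (0 named facts).

* `IsCoupling μ ν q` — a coupling of two laws given "by a distribution `q` on `X × X`" with
  marginals `Σ_y q(x,y) = μ(x)`, `Σ_x q(x,y) = ν(y)` [cite: LevinPeres2017, §4.2 (the display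
  "`Σ_y q(x,y) = μ(x)` and `Σ_x q(x,y) = ν(y)` … a coupling can be specified … by a distribution `q`
  on `X × X`")];
* `sum_mul_sub_sum_mul_eq_coupling` (`Pf(x) − Pf(y) = E_{x,y}(f(X₁) − f(Y₁))` under a coupling),
  `exists_ne_of_eigenfunction` (an eigenfunction with `λ ≠ 1` is non-constant); the optimal
  Lipschitz constant `Lip(f) = max_{x≠y} |f(x) − f(y)|/ρ(x,y)` is handled inside the proof as an
  attained maximum over the finite set of pairs [cite: LevinPeres2017, §13.1 (definition of
  `Lip(f)`)];
* **THEOREM 13.1 (M.-F. Chen 1998)** `LevinPeres2017_thm_13_1` — if `ρ ≥ 0` with `ρ(x,y) > 0`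
  for `x ≠ y`, and for each `x, y` there is a coupling `q` of
  `P(x,·)`, `P(y,·)` with **`Σ_{a,b} q(a,b) ρ(a,b) ≤ θ ρ(x,y)`** (the contraction (13.1)
  `E_{x,y} ρ(X₁,Y₁) ≤ θρ(x,y)`), then every eigenvalue `λ ≠ 1` (complex, with a complex eigenfunction)
  has **`|λ| ≤ θ`**; consequently `LevinPeres2017_thm_13_1_lambdaStar` — `λ⋆ ≤ θ` — and
  `LevinPeres2017_thm_13_1_gap` — **`γ⋆ ≥ 1 − θ`** [cite: LevinPeres2017, §13.1 Thm 13.1].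
  PROOF = the printed one: `|Pf(x) − Pf(y)| = |E(f(X₁) − f(Y₁))| ≤ Lip(f) E ρ(X₁,Y₁) ≤ θ Lip(f) ρ(x,y)`,
  i.e. `Lip(Pf) ≤ θ Lip(f)`, applied to a non-constant eigenfunction (`λ ≠ 1` forces non-constancy).
  The book asks `ρ` to be a metric and `θ < 1`; only `ρ(x,y) > 0` for `x ≠ y` and `ρ(x,x) ≥ 0` are
  used, and `θ < 1` only makes the conclusion interesting — the hypotheses here are the weaker ones.
-/

namespace Literature.Probability.MarkovChains

open Finset

variable {X : Type*} [Fintype X] [DecidableEq X]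

omit [DecidableEq X] in
/-- A COUPLING of the laws `μ` and `ν` specified by a joint distribution `q` on `X × X`:
`q ≥ 0`, `Σ_y q(x,y) = μ(x)`, `Σ_x q(x,y) = ν(y)`. [cite: LevinPeres2017, §4.2 (coupling specified
"by a distribution `q` on `X × X`" with the two marginal identities)] -/
def IsCoupling (μ ν : X → ℝ) (q : X → X → ℝ) : Prop :=
  (∀ a b, 0 ≤ q a b) ∧ (∀ a, ∑ b, q a b = μ a) ∧ (∀ b, ∑ a, q a b = ν b)

omit [DecidableEq X] in
/-- The product coupling `q(a,b) = μ(a)ν(b)` (independent coordinates) of two probability vectors.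
[cite: LevinPeres2017, §4.2 Example 4.6 (i) (independent coupling)] -/
theorem isCoupling_mul {μ ν : X → ℝ} (hμ : ∀ a, 0 ≤ μ a) (hν : ∀ b, 0 ≤ ν b)
    (hμ1 : ∑ a, μ a = 1) (hν1 : ∑ b, ν b = 1) : IsCoupling μ ν (fun a b => μ a * ν b) :=
  ⟨fun a b => mul_nonneg (hμ a) (hν b), fun a => by rw [← mul_sum, hν1, mul_one],
    fun b => by rw [← sum_mul, hμ1, one_mul]⟩

omit [DecidableEq X] in
/-- Under a coupling `q` of `P(x,·)` and `P(y,·)`: `Pf(x) − Pf(y) = Σ_{a,b} q(a,b)(f(a) − f(b))`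
("`Pf(x) − Pf(y) = E_{x,y}(f(X₁) − f(Y₁))`"). [cite: LevinPeres2017, §13.1 Thm 13.1 (proof, first
display)] -/
theorem sum_mul_sub_sum_mul_eq_coupling {P : X → X → ℝ} {x y : X} {q : X → X → ℝ}
    (hq : IsCoupling (P x) (P y) q) (f : X → ℂ) :
    ∑ a, (P x a : ℂ) * f a - ∑ b, (P y b : ℂ) * f b = ∑ a, ∑ b, (q a b : ℂ) * (f a - f b) := by
  obtain ⟨-, h1, h2⟩ := hq
  have hA : ∑ a, (P x a : ℂ) * f a = ∑ a, ∑ b, (q a b : ℂ) * f a := by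
    refine sum_congr rfl fun a _ => ?_
    rw [← sum_mul, ← h1 a]
    push_cast
    rfl
  have hB : ∑ b, (P y b : ℂ) * f b = ∑ a, ∑ b, (q a b : ℂ) * f b := by
    rw [sum_comm]
    refine sum_congr rfl fun b _ => ?_
    rw [← sum_mul, ← h2 b]
    push_cast
    rfl
  rw [hA, hB, ← sum_sub_distrib]
  refine sum_congr rfl fun a _ => ?_
  rw [← sum_sub_distrib]
  exact sum_congr rfl fun b _ => by ring

omit [DecidableEq X] in
/-- An eigenfunction with eigenvalue `λ ≠ 1` of a row-stochastic `P` is NOT constant ("Taking `φ` to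
be a non-constant eigenfunction with eigenvalue `λ`"). [cite: LevinPeres2017, §13.1 Thm 13.1 (proof)
with §12.1 Lemma 12.1 (ii)] -/
theorem exists_ne_of_eigenfunction {P : X → X → ℝ} (hP : IsRowStochastic P) {f : X → ℂ} {lam : ℂ}
    (hf : ∀ x, ∑ y, (P x y : ℂ) * f y = lam * f x) (hf0 : f ≠ 0) (hlam : lam ≠ 1) :
    ∃ x y, f x ≠ f y := by
  by_contra hcon
  push Not at hcon
  obtain ⟨x₀, hx₀⟩ : ∃ x, f x ≠ 0 := Function.ne_iff.mp hf0
  -- `f ≡ f x₀`, so `Pf(x₀) = f(x₀) = λ f(x₀)`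
  have h1 : ∑ y, (P x₀ y : ℂ) * f y = f x₀ := by
    calc ∑ y, (P x₀ y : ℂ) * f y = ∑ y, (P x₀ y : ℂ) * f x₀ :=
          sum_congr rfl fun y _ => by rw [hcon y x₀]
      _ = f x₀ := by
          rw [← sum_mul]
          have : ∑ y, (P x₀ y : ℂ) = 1 := by exact_mod_cast hP.2 x₀
          rw [this, one_mul]
  rw [hf x₀] at h1
  have h2 : (lam - 1) * f x₀ = 0 := by rw [sub_mul, h1, one_mul, sub_self]
  rcases mul_eq_zero.mp h2 with h | h
  · exact hlam (sub_eq_zero.mp h)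
  · exact hx₀ h

/-- **Theorem 13.1 (M.-F. Chen 1998): contraction in a coupling bounds every nontrivial eigenvalue.**
Let `ρ : X → X → ℝ` be non-negative with `ρ(x,y) > 0` for `x ≠ y`, `P` row-stochastic, and suppose
that for each pair `x, y` there is a coupling `q` of `P(x,·)` and `P(y,·)` with
`Σ_{a,b} q(a,b)ρ(a,b) ≤ θρ(x,y)` (i.e. `E_{x,y} ρ(X₁,Y₁) ≤ θρ(x,y)`, (13.1)).  If `λ ≠ 1` is an
eigenvalue of `P` (complex, eigenfunction `f ≠ 0`), then **`|λ| ≤ θ`**.  Proof as printed: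
`Lip(Pf) ≤ θ Lip(f)` and `Pf = λf` with `f` non-constant. [cite: LevinPeres2017, §13.1 Thm 13.1] -/
theorem LevinPeres2017_thm_13_1 {P : X → X → ℝ} (hP : IsRowStochastic P) {ρ : X → X → ℝ}
    (hρ0 : ∀ x y, 0 ≤ ρ x y) (hρ : ∀ x y, x ≠ y → 0 < ρ x y) {θ : ℝ}
    (hcontr : ∀ x y, ∃ q : X → X → ℝ, IsCoupling (P x) (P y) q ∧
      ∑ a, ∑ b, q a b * ρ a b ≤ θ * ρ x y)
    {f : X → ℂ} {lam : ℂ} (hf : ∀ x, ∑ y, (P x y : ℂ) * f y = lam * f x) (hf0 : f ≠ 0)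
    (hlam : lam ≠ 1) : ‖lam‖ ≤ θ := by
  -- the optimal Lipschitz constant of `f`, attained at a pair `(x₀, y₀)` with `x₀ ≠ y₀`
  obtain ⟨x₁, y₁, hne₁⟩ := exists_ne_of_eigenfunction hP hf hf0 hlam
  have hxy₁ : x₁ ≠ y₁ := fun h => hne₁ (by rw [h])
  set D : Finset (X × X) := univ.filter (fun p : X × X => p.1 ≠ p.2) with hD
  have hDne : D.Nonempty := ⟨(x₁, y₁), mem_filter.mpr ⟨mem_univ _, hxy₁⟩⟩
  obtain ⟨p₀, hp₀D, hmax⟩ :=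
    exists_max_image D (fun p : X × X => ‖f p.1 - f p.2‖ / ρ p.1 p.2) hDne
  set L : ℝ := ‖f p₀.1 - f p₀.2‖ / ρ p₀.1 p₀.2 with hL
  have hp₀ : p₀.1 ≠ p₀.2 := (mem_filter.mp hp₀D).2
  have hρ₀ : 0 < ρ p₀.1 p₀.2 := hρ _ _ hp₀
  -- `|f(a) − f(b)| ≤ L ρ(a,b)` for all `a, b`
  have hL0 : 0 ≤ L := div_nonneg (norm_nonneg _) (hρ0 _ _)
  have hLip : ∀ a b, ‖f a - f b‖ ≤ L * ρ a b := by
    intro a b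
    by_cases hab : a = b
    · rw [hab, sub_self, norm_zero]; exact mul_nonneg hL0 (hρ0 _ _)
    · have h := hmax (a, b) (mem_filter.mpr ⟨mem_univ _, hab⟩)
      exact (div_le_iff₀ (hρ a b hab)).mp h
  -- `L > 0`: the pair `(x₁, y₁)` has a positive quotient
  have hLpos : 0 < L := by
    have h := hmax (x₁, y₁) (mem_filter.mpr ⟨mem_univ _, hxy₁⟩)
    have hq : 0 < ‖f x₁ - f y₁‖ / ρ x₁ y₁ :=
      div_pos (norm_pos_iff.mpr (sub_ne_zero.mpr hne₁)) (hρ x₁ y₁ hxy₁)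
    exact lt_of_lt_of_le hq h
  have hfp₀ : ‖f p₀.1 - f p₀.2‖ = L * ρ p₀.1 p₀.2 := by
    rw [hL, div_mul_cancel₀ _ hρ₀.ne']
  -- the contraction at `(x₀, y₀) = p₀`
  obtain ⟨q, hq, hqρ⟩ := hcontr p₀.1 p₀.2
  have hkey : ‖lam‖ * ‖f p₀.1 - f p₀.2‖ ≤ θ * ‖f p₀.1 - f p₀.2‖ := by
    calc ‖lam‖ * ‖f p₀.1 - f p₀.2‖ = ‖lam * f p₀.1 - lam * f p₀.2‖ := by
          rw [← mul_sub, norm_mul]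
      _ = ‖∑ a, ∑ b, (q a b : ℂ) * (f a - f b)‖ := by
          rw [← hf p₀.1, ← hf p₀.2, sum_mul_sub_sum_mul_eq_coupling hq f]
      _ ≤ ∑ a, ∑ b, ‖(q a b : ℂ) * (f a - f b)‖ :=
          (norm_sum_le _ _).trans (sum_le_sum fun a _ => norm_sum_le _ _)
      _ = ∑ a, ∑ b, q a b * ‖f a - f b‖ :=
          sum_congr rfl fun a _ => sum_congr rfl fun b _ => by
            rw [norm_mul, Complex.norm_real, Real.norm_of_nonneg (hq.1 a b)]
      _ ≤ ∑ a, ∑ b, q a b * (L * ρ a b) :=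
          sum_le_sum fun a _ => sum_le_sum fun b _ => mul_le_mul_of_nonneg_left (hLip a b) (hq.1 a b)
      _ = L * ∑ a, ∑ b, q a b * ρ a b := by
          rw [mul_sum]
          refine sum_congr rfl fun a _ => ?_
          rw [mul_sum]
          exact sum_congr rfl fun b _ => by ring
      _ ≤ L * (θ * ρ p₀.1 p₀.2) := mul_le_mul_of_nonneg_left hqρ hL0
      _ = θ * ‖f p₀.1 - f p₀.2‖ := by rw [hfp₀]; ring
  have hpos : 0 < ‖f p₀.1 - f p₀.2‖ := by rw [hfp₀]; exact mul_pos hLpos hρ₀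
  exact le_of_mul_le_mul_right hkey hpos

/-- **Theorem 13.1 for `λ⋆`**: under the contraction hypothesis, `λ⋆ ≤ θ` (every nontrivial
eigenvalue of the complexified kernel has modulus `≤ θ`; for `θ ≥ 0`, which (13.1) forces whenever
`X` has two points). [cite: LevinPeres2017, §13.1 Thm 13.1] -/
theorem LevinPeres2017_thm_13_1_lambdaStar {P : X → X → ℝ} (hP : IsRowStochastic P)
    {ρ : X → X → ℝ} (hρ0 : ∀ x y, 0 ≤ ρ x y) (hρ : ∀ x y, x ≠ y → 0 < ρ x y) {θ : ℝ} (hθ : 0 ≤ θ)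
    (hcontr : ∀ x y, ∃ q : X → X → ℝ, IsCoupling (P x) (P y) q ∧
      ∑ a, ∑ b, q a b * ρ a b ≤ θ * ρ x y) :
    lambdaStar P ≤ θ := by
  unfold lambdaStar
  by_cases hne : ((fun μ : ℂ => ‖μ‖) '' nontrivialEigenvalues P).Nonempty
  · refine csSup_le hne ?_
    rintro _ ⟨μ, hμ, rfl⟩
    obtain ⟨f, hfv⟩ := hμ.1.exists_hasEigenvector
    obtain ⟨hf0, hfx⟩ := (hasEigenvector_iff P f μ).mp hfv
    exact LevinPeres2017_thm_13_1 hP hρ0 hρ hcontr hfx hf0 hμ.2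
  · rw [Set.not_nonempty_iff_eq_empty.mp hne, Real.sSup_empty]
    exact hθ

/-- **Theorem 13.1, "In particular, the absolute spectral gap satisfies `γ⋆ ≥ 1 − θ`"** (for
`θ ≥ 0`). [cite: LevinPeres2017, §13.1 Thm 13.1] -/
theorem LevinPeres2017_thm_13_1_gap {P : X → X → ℝ} (hP : IsRowStochastic P)
    {ρ : X → X → ℝ} (hρ0 : ∀ x y, 0 ≤ ρ x y) (hρ : ∀ x y, x ≠ y → 0 < ρ x y) {θ : ℝ} (hθ : 0 ≤ θ)
    (hcontr : ∀ x y, ∃ q : X → X → ℝ, IsCoupling (P x) (P y) q ∧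
      ∑ a, ∑ b, q a b * ρ a b ≤ θ * ρ x y) :
    1 - θ ≤ absSpectralGap P := by
  unfold absSpectralGap
  linarith [LevinPeres2017_thm_13_1_lambdaStar hP hρ0 hρ hθ hcontr]

end Literature.Probability.MarkovChains
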